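import Literature.Barriers.Parity.ElliottOriginalFormProofs
import Literature.Barriers.Parity.LogarithmicAveraging
import Literature.NumberTheory.LFunctions.MertensFormula
import HarnessLib

/-!
# Barrier catalogue `Parity`, entry `ElliottOriginalForm` — NARROWED (barrier audit, D-0021)

Topic `Literature/Barriers/Parity`. The catalogued record
`Literature.Barriers.Parity.MatomakiRadziwillTao2015_counterexample` (Matomäki–Radziwiłł–Tao 2015,
Theorem B.1) is TRUE — it is proved in the tree (`MatomakiRadziwillTao2015_counterexample_holds`,
file `ElliottOriginalFormProofs.lean`), and so is `¬ ElliottConjectureOriginal`. What the 2026-08-16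
audit narrows is the SCOPE its BARRIER block claims (`blocks:` "consequently no argument deriving
`o(X)` … binary correlation bounds for general `1`-bounded multiplicative functions can use less
than locally-uniform-in-`t` non-pretentiousness"). Two things are sharper than that sentence, and
this file records them — one as a named fact from the post-2015 literature, the rest PROVED:

1. **Only ALL-SCALES conclusions are obstructed.** Under Elliott's ORIGINAL (pointwise)
   hypothesis the two-point correlation of `1`-bounded multiplicative functions DOES tend to `0`
   along a set of scales of full upper logarithmic density (Klurman–Mangerel–Teräväinen 2023,
   Theorem 1.2 — the named fact `KlurmanMangerelTeravainen2023_twoPoint` below; the qualitative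
   "along a subsequence" version is AIM 2018 Problem 7.3, also settled by
   Frantzikinakis–Lemańczyk–de la Rue, and for the MRT class itself Chowla of every order holds
   along a subsequence, Gomilko–Lemańczyk–de la Rue 2021). Consequently the barrier cannot be
   upgraded from "large along the constructed `t_m → ∞`" to "large for all large `X`":
   `not_counterexample_allScales` (PROVED from the fact) — every pointwise non-pretentious `g` has
   `lim inf_X |∑_{n ≤ X} g(n)ḡ(n+1)|/X = 0`. On the other side, `δ⁺_log = 1` is optimal: it cannot
   be improved to `δ_log = 1` or to `δ⁺_loglog = 1` (KMT Proposition 1.3, a STRONGER MRT-type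
   counterexample), so "outside a set of scales of logarithmic density `0`" (the shape of
   Tao–Teräväinen 2019, Corollary 1.13, under the corrected hypothesis) IS obstructed under (1.6).
2. **"Locally uniform in `t`" has exactly one meaning across power windows, and the original
   hypothesis is exactly the bounded-window one.** For `1`-bounded `g`:
   `inf_{|t| ≤ x^c} 𝔻(g, χ(n)n^{it}; x)² → ∞` for every `χ` is EQUIVALENT to the corrected
   hypothesis `Literature.NumberTheory.Sieve.IsNonpretentious` (window `|t| ≤ x`, MRT (1.8)) for
   every fixed `c > 0` (`ElliottWindow.isNonpretentious_iff_powWindow`, PROVED: growing the height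
   from `x` to `x^a` adds at most `2 log a + o(1)` to `𝔻²`, Mertens) — so Tao's window
   `|t| ≤ A x^{k-1}` (KMT Conjecture 2.12) and MRT's `|t| ≤ X` are the same asymptotic hypothesis
   on a fixed function; and `IsPointwiseNonpretentious` (MRT (1.6)) is EQUIVALENT to uniformity on
   every BOUNDED window `|t| ≤ A` (`ElliottWindow.isPointwiseNonpretentious_iff_boundedWindow`,
   PROVED: Dini — `t ↦ 𝔻(g, χ(n)n^{it}; x)²` is continuous and increasing in `x`). Hence the only
   hypotheses strictly between the refuted (1.6) and the corrected (1.8) are growing SUB-POWER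
   windows `|t| ≤ ψ(x)`, `ψ → ∞`, `ψ(x) = x^{o(1)}`, about which nothing is printed either way
   (Theorem B.1's pretender frequency at scale `X = t_{m+1}` is `s_{m+1} = X^{1/2}` in print and
   `≤ X/60000` in the tree's construction, whose `t_{m+1}` is otherwise unconstrained).

## What the sources print (arXiv versions; verified on the page)

* O. Klurman, A. P. Mangerel, J. Teräväinen, *On Elliott's conjecture and applications*,
  arXiv:2304.05344 [cite: KlurmanMangerelTeravainen2023, Definition 1.1, Theorem 1.2, Proposition 1.3, §2.5 (Conjectures 2.10, 2.12, Proposition 2.13), Lemma 5.3].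
  Definition 1.1: "`f` is pretentious if there exist a Dirichlet character `χ` and a real number
  `t` such that `𝔻(f, χ(n)n^{it}; ∞) < ∞` … If `f` is not pretentious, we say that it is
  non-pretentious" — i.e. KMT's "non-pretentious" IS Elliott's original hypothesis
  `IsPointwiseNonpretentious`. "A deep and influential conjecture of Elliott [Mem. AMS 538, 1994]
  states that if `f₁, …, f_k : ℕ → 𝔻` are multiplicative functions with `f₁` non-pretentious,
  then the correlation averages tend to `0` … The original formulation of Elliott's conjecture
  turns out to be technically false, with a counterexample constructed by Matomäki, Radziwiłł and
  Tao. The conjecture can be corrected … by strengthening the hypothesis …; (we pose as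
  Conjecture 2.10 another possible way to correct Elliott's conjecture without strengthening the
  hypothesis on `f₁`)." Theorem 1.2 (Two-point Elliott conjecture at almost all scales): "Let
  `f₁, f₂ : ℕ → 𝔻` be multiplicative functions. Suppose that `f₁` is non-pretentious. Then there
  exists a set `𝒳 ⊂ ℕ` with `δ⁺_log(𝒳) = 1` such that for any distinct `h₁, h₂ ∈ ℕ` we have
  `lim_{x→∞, x∈𝒳} (1/x) ∑_{n ≤ x} f₁(n+h₁) f₂(n+h₂) = 0`." Then: "This result settles the
  two-point case of Problem 7.3 of the 2018 AIM conference on Sarnak's conjecture in a strong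
  form. This problem asks if the non-pretentiousness of `f` is enough for the two-point
  correlations of `f` and `f̄` to tend to `0` along a subsequence. … the same qualitative problem
  was solved by Frantzikinakis, Lemańczyk and de la Rue [FLR] … Theorem 1.2 is essentially
  optimal … the condition `δ⁺_log(𝒳) = 1` cannot be strengthened to `δ_log(𝒳) = 1`, or even to
  `δ⁺_loglog(𝒳) = 1`". Proposition 1.3: "For every `δ > 0`, there exists a non-pretentious
  multiplicative function `f : ℕ → 𝔻` and a set `𝒳 ⊂ ℕ` with `δ⁺_loglog(𝒳) = 1` such that
  `lim_{x→∞, x∈𝒳} |(1/x) ∑_{n ≤ x} f(n) f̄(n+1)| ≥ 1 - δ`." §2.5: "Theorems 1.2 and 1.6 give some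
  indication that Elliott's original formulation of his conjecture may be almost right";
  Conjecture 2.10 (modified Elliott: `f₁` non-pretentious ⟹ all `k`-point correlations vanish
  along some `𝒳`, `δ⁺_log(𝒳) = 1`, depending only on `f₁`); Conjecture 2.12 (Tao's corrected
  asymptotic Elliott conjecture, hypothesis `inf_{|t| ≤ A x^{k-1}} 𝔻(f₁, χ(n)n^{it}; x) ≥ A` for
  `χ` of modulus `≤ A`); Proposition 2.13: "Conjecture 2.12 implies Conjecture 2.10 … Thus, if
  Conjecture 2.12 holds, then Elliott's original conjecture holds at almost all scales in the
  sense of Conjecture 2.10". Lemma 5.3 (rigidity across scales `x_n + 1 ≤ x_{n+1} ≤ x_n^A`), proof: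
  "`𝔻(f, χ_m(n)n^{it_m}; x_{m+1})² ≤ F(x_m)² + O(∑_{x_m < p ≤ x_{m+1}} 1/p) ≤ F(x_m)² + O(1)`".
* A. Gomilko, M. Lemańczyk, T. de la Rue, J. Mod. Dyn. 17 (2021), arXiv:2006.09958
  [cite: GomilkoLemanczykDelarue2021, Abstract and Main Theorem]: "It is shown that in a class of
  counterexamples to Elliott's conjecture by Matomäki, Radziwiłł and Tao, the Chowla conjecture
  holds along a subsequence"; Main Theorem: for `u` in the MRT class "the Bernoulli shift
  `((𝕊¹)^ℕ, Leb^{⊗ℕ}, S)` is also a Furstenberg system of `u`", and "our Main Theorem yields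
  positive answers to questions raised in Problem 7.3 [AIM workshop] in the class of MRT functions".
* N. Frantzikinakis, M. Lemańczyk, T. de la Rue, Ergodic Theory Dynam. Systems 45 (2025),
  arXiv:2304.03121 [cite: FrantzikinakisLemanczykDelarue2025, §2.3 (before Theorem 2.15) and Theorem 2.17]:
  "all MRT functions satisfy the Sarnak and the Chowla–Elliott conjecture along some subsequence
  `(N_k)` (this is a consequence of the main result in [GLR21])"; Theorem 2.17: "All MRT
  multiplicative functions are aperiodic (non-pretentious)."
* For MRT 2015 (Conjecture 1.5, (1.6)–(1.8), Theorem B.1, Appendix C) and Tao 2016 (Remark 1.6)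
  see the catalogue file `ElliottOriginalForm.lean`; for Hall / Tao–Teräväinen on densities of
  scales see `LogarithmicAveraging.lean` (whose `logMean` is used below).

## Main statements

* `ElliottWindow.pretentiousDistSq_rpow_le` — `𝔻(g,f;x^a)² ≤ 𝔻(g,f;x)² + 2 log a + 32/log x`;
* `ElliottWindow.isNonpretentious_iff_powWindow` — power windows `|t| ≤ x^c` ⟺ MRT (1.8);
* `ElliottWindow.isPointwiseNonpretentious_iff_boundedWindow` — MRT (1.6) ⟺ bounded windows;
* `KlurmanMangerelTeravainen2023_twoPoint` — KMT Theorem 1.2 (named fact; EVASION record);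
* `not_counterexample_allScales` — no pointwise non-pretentious `g` has
  `|∑_{n ≤ X} g(n)ḡ(n+1)| ≥ cX` for ALL large `X` (PROVED from the fact).

Design. No new densities are introduced: "`δ⁺_log(𝒳) = 1`" is written with the tree's
`logMean` (Hall's normalisation `(1/log X) ∑_{n ≤ X, n ∈ 𝒳} 1/n`) as
`∀ ε > 0, ∃ᶠ X, 1 - ε ≤ logMean 1_𝒳 X`, which is equivalent to `lim sup = 1` because
`logMean 1_𝒳 X ≤ H_X/log X → 1`. KMT's shifts `h₁, h₂ ∈ ℕ = {1, 2, …}` are rendered `1 ≤ hᵢ`.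
Window infima are the tree's `⨅ t : Set.Icc (-W) W, pretentiousDistSq g (twistedChar χ t) x`
(`charNonpretentiousness` is the case `W = x`), bounded below by `0` for `1`-bounded `g`.
-/

noncomputable section

open Filter Finset Topology Complex
open scoped ComplexConjugate

namespace Literature.Barriers.Parity

open Literature.NumberTheory.Sieve Literature.NumberTheory.LFunctions.Mertens

namespace ElliottWindow

/-! ### Growing the height costs at most twice the prime reciprocal mass in between -/

/-- `𝔻(g, f; y)² - 𝔻(g, f; x)² ≤ 2 (P(y) - P(x))` for `1`-bounded `g, f` and `x ≤ y`, where
`P(x) = ∑_{p ≤ x} 1/p`: the summands of the pretentious distance lie in `[0, 2/p]`.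
[cite: KlurmanMangerelTeravainen2023, Lemma 5.3 (proof, first display)] -/
theorem pretentiousDistSq_sub_le {g f : ℕ → ℂ} (hg : ∀ n, ‖g n‖ ≤ 1) (hf : ∀ n, ‖f n‖ ≤ 1)
    {x y : ℝ} (hxy : x ≤ y) :
    pretentiousDistSq g f y - pretentiousDistSq g f x ≤ 2 * (primeRecipSum y - primeRecipSum x) := by
  have hsub : Nat.primesLE ⌊x⌋₊ ⊆ Nat.primesLE ⌊y⌋₊ := Nat.primesLE_mono (Nat.floor_le_floor hxy)
  unfold pretentiousDistSq primeRecipSum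
  rw [← Finset.sum_sdiff hsub, ← Finset.sum_sdiff hsub (f := fun p : ℕ => (p : ℝ)⁻¹), add_sub_cancel_right,
    add_sub_cancel_right, Finset.mul_sum]
  refine Finset.sum_le_sum fun p hp => ?_
  have hpp : p.Prime := Nat.prime_of_mem_primesLE (Finset.mem_sdiff.1 hp).1
  have hp0 : (0 : ℝ) < p := by exact_mod_cast hpp.pos
  rw [div_eq_mul_inv]
  refine mul_le_mul_of_nonneg_right ?_ (inv_nonneg.2 hp0.le)
  have h1 : |(g p * conj (f p)).re| ≤ 1 := by
    refine (Complex.abs_re_le_norm _).trans ?_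
    rw [norm_mul, Complex.norm_conj]
    exact mul_le_one₀ (hg p) (norm_nonneg _) (hf p)
  linarith [neg_abs_le (g p * conj (f p)).re]

/-- Mertens with rate, window form: `P(y) - P(x) ≤ log log y - log log x + 16/log x` for
`2 ≤ x ≤ y` (`|P(x) - log log x - B₁| ≤ 8/log x`). [cite: HardyWright2008, Thm 427 (§22.7)] -/
theorem primeRecipSum_window_le {x y : ℝ} (hx : 2 ≤ x) (hxy : x ≤ y) :
    primeRecipSum y - primeRecipSum x
      ≤ Real.log (Real.log y) - Real.log (Real.log x) + 16 / Real.log x := by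
  have hy : 2 ≤ y := hx.trans hxy
  have h1 := abs_le.1 (abs_primeRecipSum_sub_le hx)
  have h2 := abs_le.1 (abs_primeRecipSum_sub_le hy)
  have hlogx : 0 < Real.log x := Real.log_pos (by linarith)
  have hlog : Real.log x ≤ Real.log y := Real.log_le_log (by linarith) hxy
  have h3 : 8 / Real.log y ≤ 8 / Real.log x := div_le_div_of_nonneg_left (by norm_num) hlogx hlog
  have h4 : (16 : ℝ) / Real.log x = 8 / Real.log x + 8 / Real.log x := by ring
  linarith [h1.1, h2.2]

/-- `log log (x^a) = log a + log log x` for `x > 1`, `a > 0`. [folklore] -/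
theorem loglog_rpow {x a : ℝ} (hx : 1 < x) (ha : 0 < a) :
    Real.log (Real.log (x ^ a)) = Real.log a + Real.log (Real.log x) := by
  rw [Real.log_rpow (by linarith), Real.log_mul ha.ne' (Real.log_pos hx).ne']

/-- **Scale change.** For `1`-bounded `g, f`, `x ≥ 2` and `a ≥ 1`:
`𝔻(g, f; x^a)² ≤ 𝔻(g, f; x)² + 2 log a + 32/log x` — passing from height `x` to height `x^a`
adds at most `2 ∑_{x < p ≤ x^a} 1/p = 2 log a + o(1)` to the squared distance (the step
"`O(∑_{x_m < p ≤ x_{m+1}} 1/p) = O(1)` for `x_{m+1} ≤ x_m^A`" of the rigidity lemma).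
[cite: KlurmanMangerelTeravainen2023, Lemma 5.3 (proof, first display)] -/
theorem pretentiousDistSq_rpow_le {g f : ℕ → ℂ} (hg : ∀ n, ‖g n‖ ≤ 1) (hf : ∀ n, ‖f n‖ ≤ 1)
    {x a : ℝ} (hx : 2 ≤ x) (ha : 1 ≤ a) :
    pretentiousDistSq g f (x ^ a) ≤ pretentiousDistSq g f x + 2 * Real.log a + 32 / Real.log x := by
  have hx1 : 1 < x := by linarith
  have hxa : x ≤ x ^ a := by
    calc x = x ^ (1 : ℝ) := (Real.rpow_one x).symm
      _ ≤ x ^ a := Real.rpow_le_rpow_of_exponent_le hx1.le ha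
  have h1 := pretentiousDistSq_sub_le hg hf hxa
  have h2 := primeRecipSum_window_le hx hxa
  rw [loglog_rpow hx1 (by linarith)] at h2
  have h3 : (32 : ℝ) / Real.log x = 2 * (16 / Real.log x) := by ring
  linarith

/-! ### Windows in `t`: `inf_{|t| ≤ W} 𝔻(g, χ(n)n^{it}; x)²` -/

variable {g : ℕ → ℂ}

/-- The window infimum is at most any of its values: `inf_{|t| ≤ W} 𝔻² ≤ 𝔻²(t₀)` for
`|t₀| ≤ W` (the family is bounded below by `0`). [folklore] -/
theorem iInf_window_le (hg : ∀ n, ‖g n‖ ≤ 1) {q : ℕ} (χ : DirichletCharacter ℂ q) {W x t₀ : ℝ}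
    (ht₀ : t₀ ∈ Set.Icc (-W) W) :
    (⨅ t : Set.Icc (-W) W, pretentiousDistSq g (twistedChar χ (t : ℝ)) x)
      ≤ pretentiousDistSq g (twistedChar χ t₀) x := by
  refine ciInf_le ⟨0, ?_⟩ (⟨t₀, ht₀⟩ : Set.Icc (-W) W)
  rintro _ ⟨t, rfl⟩
  exact pretentiousDistSq_nonneg hg (norm_twistedChar_le_one χ _) x

/-- A lower bound valid at every `|t| ≤ W` (with `W ≥ 0`) bounds the window infimum from below.
[folklore] -/
theorem le_iInf_window {q : ℕ} (χ : DirichletCharacter ℂ q) {W x B : ℝ} (hW : 0 ≤ W)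
    (h : ∀ t : ℝ, t ∈ Set.Icc (-W) W → B ≤ pretentiousDistSq g (twistedChar χ t) x) :
    B ≤ ⨅ t : Set.Icc (-W) W, pretentiousDistSq g (twistedChar χ (t : ℝ)) x := by
  have : Nonempty (Set.Icc (-W) W) := ⟨⟨0, by simp [hW]⟩⟩
  exact le_ciInf fun t => h t t.2

/-- **Window transfer.** If `inf_{|t| ≤ W₁(y)} 𝔻(g, χ(n)n^{it}; y)² → ∞` and eventually
`0 ≤ W₂(x) ≤ W₁(x^a)` for some fixed `a ≥ 1`, then `inf_{|t| ≤ W₂(x)} 𝔻(g, χ(n)n^{it}; x)² → ∞`: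
evaluate the first window at the scale `y = x^a` and come back down with `pretentiousDistSq_rpow_le`.
[cite: KlurmanMangerelTeravainen2023, Lemma 5.3 (rigidity of the pretentious distance across scales)] -/
theorem tendsto_iInf_window_of_le (hg : ∀ n, ‖g n‖ ≤ 1) {q : ℕ} (χ : DirichletCharacter ℂ q)
    {W₁ W₂ : ℝ → ℝ} {a : ℝ} (ha : 1 ≤ a)
    (hW : ∀ᶠ x in atTop, 0 ≤ W₂ x ∧ W₂ x ≤ W₁ (x ^ a))
    (h : Tendsto (fun y : ℝ => ⨅ t : Set.Icc (-(W₁ y)) (W₁ y),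
      pretentiousDistSq g (twistedChar χ (t : ℝ)) y) atTop atTop) :
    Tendsto (fun x : ℝ => ⨅ t : Set.Icc (-(W₂ x)) (W₂ x),
      pretentiousDistSq g (twistedChar χ (t : ℝ)) x) atTop atTop := by
  have ha0 : 0 < a := by linarith
  rw [tendsto_atTop]
  intro B
  have hpow : Tendsto (fun x : ℝ => x ^ a) atTop atTop := tendsto_rpow_atTop ha0
  have h1 : ∀ᶠ x : ℝ in atTop, B + 2 * Real.log a + 16 ≤ ⨅ t : Set.Icc (-(W₁ (x ^ a))) (W₁ (x ^ a)),
      pretentiousDistSq g (twistedChar χ (t : ℝ)) (x ^ a) :=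
    hpow.eventually (tendsto_atTop.1 h (B + 2 * Real.log a + 16))
  have h2 : ∀ᶠ x : ℝ in atTop, Real.exp 2 ≤ x := eventually_ge_atTop _
  filter_upwards [h1, h2, hW] with x hx1 hx2 hW
  have hx2' : (2 : ℝ) ≤ x := by
    have := Real.add_one_le_exp (2 : ℝ)
    linarith
  have hlog2 : 2 ≤ Real.log x := by
    rw [Real.le_log_iff_exp_le (by linarith)]
    exact hx2
  have h16 : 32 / Real.log x ≤ 16 := by
    rw [div_le_iff₀ (by linarith)]
    linarith
  refine le_iInf_window χ hW.1 fun t ht => ?_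
  have ht' : t ∈ Set.Icc (-(W₁ (x ^ a))) (W₁ (x ^ a)) := ⟨by linarith [ht.1, hW.2], ht.2.trans hW.2⟩
  have h3 := iInf_window_le hg χ (x := x ^ a) ht'
  have h4 := pretentiousDistSq_rpow_le hg (norm_twistedChar_le_one χ t) hx2' ha
  linarith

/-- **Power windows are all equivalent to the corrected hypothesis.** For `1`-bounded `g` and any
fixed `c > 0`: `inf_{|t| ≤ x^c} 𝔻(g, χ(n)n^{it}; x)² → ∞` for every `χ` iff
`Literature.NumberTheory.Sieve.IsNonpretentious g` (the window `|t| ≤ x` of MRT (1.8)). In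
particular Tao's window `|t| ≤ A x^{k-1}` and MRT's `|t| ≤ X` give the same ASYMPTOTIC hypothesis
on a fixed function; "locally uniform in `t`" has one meaning across all power windows.
[cite: KlurmanMangerelTeravainen2023, Conjecture 2.12 (window `A x^{k-1}`) and Theorem A (window `x`)] -/
theorem isNonpretentious_iff_powWindow (hg : ∀ n, ‖g n‖ ≤ 1) {c : ℝ} (hc : 0 < c) :
    (∀ (q : ℕ) [NeZero q] (χ : DirichletCharacter ℂ q),
      Tendsto (fun x : ℝ => ⨅ t : Set.Icc (-(x ^ c)) (x ^ c),
        pretentiousDistSq g (twistedChar χ (t : ℝ)) x) atTop atTop)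
    ↔ IsNonpretentious g := by
  constructor
  · intro h q _ χ
    -- window `x` from window `y^c` at `y = x^a`, `a c ≥ 1`
    set a : ℝ := max 1 (1 / c) with ha
    have ha1 : 1 ≤ a := le_max_left _ _
    have hac : 1 ≤ a * c := by
      have : 1 / c ≤ a := le_max_right _ _
      have h' : 1 / c * c = 1 := by field_simp
      nlinarith
    refine tendsto_iInf_window_of_le (W₁ := fun y => y ^ c) (W₂ := fun x => x) hg χ ha1 ?_ (h q χ)
    filter_upwards [eventually_ge_atTop (1 : ℝ)] with x hx
    refine ⟨by linarith, ?_⟩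
    calc x = x ^ (1 : ℝ) := (Real.rpow_one x).symm
      _ ≤ x ^ (a * c) := Real.rpow_le_rpow_of_exponent_le hx hac
      _ = (x ^ a) ^ c := Real.rpow_mul (by linarith) a c
  · intro h q _ χ
    set a : ℝ := max 1 c with ha
    have ha1 : 1 ≤ a := le_max_left _ _
    refine tendsto_iInf_window_of_le (W₁ := fun y => y) (W₂ := fun x => x ^ c) hg χ ha1 ?_ (h q χ)
    filter_upwards [eventually_ge_atTop (1 : ℝ)] with x hx
    exact ⟨Real.rpow_nonneg (by linarith) c, Real.rpow_le_rpow_of_exponent_le hx (le_max_right _ _)⟩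

/-! ### Bounded windows: the original hypothesis is uniform on compact `t`-sets (Dini) -/

/-- `t ↦ 𝔻(g, χ(n)n^{it}; x)²` is continuous (a finite sum of continuous functions of `t`).
[folklore] -/
theorem continuous_pretentiousDistSq_twistedChar (g : ℕ → ℂ) {q : ℕ} (χ : DirichletCharacter ℂ q)
    (x : ℝ) : Continuous fun t : ℝ => pretentiousDistSq g (twistedChar χ t) x := by
  unfold pretentiousDistSq twistedChar
  refine continuous_finsetSum _ fun p hp => ?_
  have hp0 : (p : ℂ) ≠ 0 := by exact_mod_cast (Nat.prime_of_mem_primesLE hp).ne_zero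
  have hc : Continuous fun t : ℝ => (p : ℂ) ^ ((t : ℂ) * I) :=
    (Complex.continuous_ofReal.mul continuous_const).const_cpow (Or.inl hp0)
  have h1 : Continuous fun t : ℝ => g p * conj (χ p * (p : ℂ) ^ ((t : ℂ) * I)) :=
    continuous_const.mul (Complex.continuous_conj.comp (continuous_const.mul hc))
  exact (continuous_const.sub (Complex.continuous_re.comp h1)).div_const _

/-- **MRT (1.6) is exactly bounded-window uniformity.** For `1`-bounded `g`:
`IsPointwiseNonpretentious g` (for each fixed `χ, t`, `𝔻(g, χ(n)n^{it}; x)² → ∞`) iff for each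
fixed `χ` and each bounded window `A ≥ 0`, `inf_{|t| ≤ A} 𝔻(g, χ(n)n^{it}; x)² → ∞`. (Dini: the
functions `t ↦ 𝔻(g, χ(n)n^{it}; x)²` are continuous and increase with `x`; a compact window is
covered by finitely many neighbourhoods on each of which one height already exceeds the bound.)
So the hypothesis refuted by Theorem B.1 is "uniformity on bounded windows", the corrected one
is "uniformity on power windows" (`isNonpretentious_iff_powWindow`).
[cite: MatomakiRadziwillTao2015, §1.1 ((1.6) versus (1.8))] -/
theorem isPointwiseNonpretentious_iff_boundedWindow (hg : ∀ n, ‖g n‖ ≤ 1) :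
    IsPointwiseNonpretentious g ↔
      ∀ (q : ℕ) [NeZero q] (χ : DirichletCharacter ℂ q) (A : ℝ), 0 ≤ A →
        Tendsto (fun x : ℝ => ⨅ t : Set.Icc (-A) A,
          pretentiousDistSq g (twistedChar χ (t : ℝ)) x) atTop atTop := by
  constructor
  · intro h q _ χ A hA
    rw [tendsto_atTop]
    intro B
    -- for each `t₀` a height `x₀(t₀)` beyond which `𝔻² > B` on a neighbourhood of `t₀`
    have key : ∀ t₀ : ℝ, ∃ x₀ : ℝ, ∃ U : Set ℝ, IsOpen U ∧ t₀ ∈ U ∧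
        ∀ t ∈ U, ∀ x, x₀ ≤ x → B ≤ pretentiousDistSq g (twistedChar χ t) x := by
      intro t₀
      obtain ⟨x₀, hx₀⟩ := ((h q χ t₀).eventually (eventually_gt_atTop B)).exists
      refine ⟨x₀, {t | B < pretentiousDistSq g (twistedChar χ t) x₀},
        isOpen_lt continuous_const (continuous_pretentiousDistSq_twistedChar g χ x₀), hx₀, ?_⟩
      intro t ht x hx
      exact (lt_of_lt_of_le ht (pretentiousDistSq_mono hg (norm_twistedChar_le_one χ t) hx)).le
    choose x₀ U hUo hUmem hU using key
    obtain ⟨s, hs⟩ := (isCompact_Icc (a := -A) (b := A)).elim_finite_subcover U hUo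
      (fun t _ => Set.mem_iUnion.2 ⟨t, hUmem t⟩)
    obtain ⟨M, hM⟩ := (s.image x₀).bddAbove
    filter_upwards [eventually_ge_atTop M] with x hx
    refine le_iInf_window χ hA fun t ht => ?_
    obtain ⟨i, hi, hti⟩ := Set.mem_iUnion₂.1 (hs ht)
    have hiM : x₀ i ≤ M := hM (Finset.mem_coe.2 (Finset.mem_image_of_mem x₀ hi))
    exact hU i t hti x (hiM.trans hx)
  · intro h q _ χ t
    refine tendsto_atTop_mono (fun x => ?_) (h q χ |t| (abs_nonneg t))
    exact iInf_window_le hg χ ⟨neg_abs_le t, le_abs_self t⟩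

end ElliottWindow

/-! ### The evasion on the conclusion side: vanishing along a dense set of scales -/

/-- **Klurman–Mangerel–Teräväinen 2023, Theorem 1.2 (two-point correlations vanish at almost
all scales under Elliott's ORIGINAL hypothesis; a THEOREM in print).** Let `f₁, f₂ : ℕ → 𝔻` be
multiplicative with `f₁` non-pretentious in the POINTWISE sense (`𝔻(f₁, χ(n)n^{it}; ∞) = ∞` for
every Dirichlet character `χ` and every real `t`, i.e. `IsPointwiseNonpretentious f₁` — KMT
Definition 1.1). Then there is a set of scales `𝒳 ⊆ ℕ` of full UPPER logarithmic density,
`δ⁺_log(𝒳) = 1`, such that for any distinct `h₁, h₂ ≥ 1`,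
`(1/x) ∑_{n ≤ x} f₁(n + h₁) f₂(n + h₂) → 0` as `x → ∞` through `𝒳`. Here `δ⁺_log(𝒳) = 1` is
written `∀ ε > 0, (1/log X) ∑_{n ≤ X, n ∈ 𝒳} 1/n ≥ 1 - ε` for arbitrarily large `X` (`logMean`
of `LogarithmicAveraging.lean`). Named fact: PROVED by Klurman–Mangerel–Teräväinen (their §7.1,
combining a strengthening of Tao–Teräväinen's almost-all-scales theorem with the rigidity Lemma
5.3 and the entropy-decrement method; none of this machinery is in the tree). EVASION record for
the catalogue entry `MatomakiRadziwillTao2015_counterexample`: the ORIGINAL hypothesis (1.6) does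
force binary cancellation along a set of scales of full upper logarithmic density — only
ALL-scales (and `δ_log`- or `δ⁺_loglog`-almost-all-scales, KMT Proposition 1.3) conclusions are
obstructed by Theorem B.1; the qualitative "along a subsequence" version (item 7.3 of the 2018
AIM workshop list) is also due to Frantzikinakis–Lemańczyk–de la Rue, and for the MRT class the
autocorrelations of every order vanish along a subsequence (Gomilko–Lemańczyk–de la Rue, Main
Theorem: the Bernoulli shift is a Furstenberg system).
[cite: KlurmanMangerelTeravainen2023, Theorem 1.2 and Definition 1.1]
[cite: GomilkoLemanczykDelarue2021, Main Theorem]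
[cite: FrantzikinakisLemanczykDelarue2025, §2.3 and Theorem 2.17] -/
def KlurmanMangerelTeravainen2023_twoPoint : Prop :=
  ∀ (f₁ f₂ : ArithmeticFunction ℂ), f₁.IsMultiplicative → f₂.IsMultiplicative →
    (∀ n, ‖f₁ n‖ ≤ 1) → (∀ n, ‖f₂ n‖ ≤ 1) → IsPointwiseNonpretentious f₁ →
    ∃ 𝒳 : Set ℕ,
      (∀ ε : ℝ, 0 < ε → ∃ᶠ X : ℕ in atTop, 1 - ε ≤ logMean (Set.indicator 𝒳 1) X) ∧
      ∀ h₁ h₂ : ℕ, 1 ≤ h₁ → 1 ≤ h₂ → h₁ ≠ h₂ →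
        Tendsto (fun x : ℕ => (∑ n ∈ Icc 1 x, f₁ (n + h₁) * f₂ (n + h₂)) / (x : ℂ))
          (atTop ⊓ 𝓟 𝒳) (𝓝 0)

/-- A set of scales of positive upper logarithmic density is unbounded: if
`(1/log X) ∑_{n ≤ X, n ∈ 𝒳} 1/n ≥ 1/2` for arbitrarily large `X` then `𝒳 ⊄ [0, N]` for every `N`
(a set inside `[0, N]` has `∑ 1/n ≤ N`, and `N/log X → 0`). [folklore] -/
theorem exists_mem_gt_of_frequently_logMean {𝒳 : Set ℕ}
    (h : ∃ᶠ X : ℕ in atTop, (1 / 2 : ℝ) ≤ logMean (Set.indicator 𝒳 1) X) (N : ℕ) :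
    ∃ x ∈ 𝒳, N < x := by
  by_contra hcon
  push Not at hcon
  have hbound : ∀ X : ℕ, ∑ n ∈ Icc 1 X, Set.indicator 𝒳 (1 : ℕ → ℝ) n / n ≤ N := by
    intro X
    calc ∑ n ∈ Icc 1 X, Set.indicator 𝒳 (1 : ℕ → ℝ) n / n
        ≤ ∑ n ∈ Icc 1 X, (if n ≤ N then (1 : ℝ) else 0) := by
          refine Finset.sum_le_sum fun n hn => ?_
          have hn1 : 1 ≤ n := (Finset.mem_Icc.1 hn).1
          have hn0 : (0 : ℝ) < n := by exact_mod_cast hn1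
          by_cases hmem : n ∈ 𝒳
          · rw [Set.indicator_of_mem hmem, Pi.one_apply, if_pos (hcon n hmem), div_le_one hn0]
            exact_mod_cast hn1
          · rw [Set.indicator_of_notMem hmem, zero_div]
            split_ifs <;> norm_num
      _ ≤ ∑ n ∈ Icc 1 N, (1 : ℝ) := by
          rw [← Finset.sum_filter]
          refine Finset.sum_le_sum_of_subset_of_nonneg ?_ (fun _ _ _ => zero_le_one)
          intro n hn
          simp only [Finset.mem_filter, Finset.mem_Icc] at hn ⊢
          omega
      _ = N := by simp
  have hlog : Tendsto (fun X : ℕ => Real.log X) atTop atTop :=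
    Real.tendsto_log_atTop.comp tendsto_natCast_atTop_atTop
  have h0 : Tendsto (fun X : ℕ => (N : ℝ) / Real.log X) atTop (𝓝 0) :=
    tendsto_const_nhds.div_atTop hlog
  have hev : ∀ᶠ X : ℕ in atTop, logMean (Set.indicator 𝒳 1) X < 1 / 2 := by
    filter_upwards [h0.eventually (gt_mem_nhds (by norm_num : (0 : ℝ) < 1 / 2)),
      hlog.eventually (eventually_gt_atTop 0)] with X hX hlogpos
    calc logMean (Set.indicator 𝒳 1) X
        = (∑ n ∈ Icc 1 X, Set.indicator 𝒳 (1 : ℕ → ℝ) n / n) / Real.log X := rfl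
      _ ≤ N / Real.log X := div_le_div_of_nonneg_right (hbound X) hlogpos.le
      _ < 1 / 2 := hX
  obtain ⟨X, hX1, hX2⟩ := (h.and_eventually hev).exists
  linarith

/-- Peeling the first term and shifting: `∑_{1 ≤ n ≤ x+1} G(n) = G(1) + ∑_{1 ≤ n ≤ x} G(n+1)`.
[folklore] -/
theorem sum_Icc_succ_eq_add_sum_shift (G : ℕ → ℂ) (x : ℕ) :
    ∑ n ∈ Icc 1 (x + 1), G n = G 1 + ∑ n ∈ Icc 1 x, G (n + 1) := by
  induction x with
  | zero => simp
  | succ x ih =>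
    rw [Finset.sum_Icc_succ_top (by omega), ih, Finset.sum_Icc_succ_top (by omega)]
    ring

/-- **The barrier cannot be upgraded to all large scales** (AUDIT 2026-08-16). Modulo
Klurman–Mangerel–Teräväinen's Theorem 1.2 (`KlurmanMangerelTeravainen2023_twoPoint`): there is
NO `1`-bounded multiplicative `g` with `M(g; ∞, ∞) = ∞` (Elliott's original hypothesis) whose
correlation satisfies `|∑_{n ≤ X} g(n) conj g(n+1)| ≥ c X` for ALL sufficiently large `X` —
whereas Theorem B.1 (`MatomakiRadziwillTao2015_counterexample_holds`, proved) gives exactly this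
along SOME sequence `T_m → ∞`. Indeed KMT supply scales `x → ∞` (a set of upper logarithmic
density `1` is unbounded) with `∑_{n ≤ x} g(n+1) conj g(n+2) = o(x)`, and
`∑_{n ≤ x+1} g(n) conj g(n+1) = g(1) conj g(2) + ∑_{n ≤ x} g(n+1) conj g(n+2)`. So every
pointwise non-pretentious `g` has `lim inf_X |∑_{n ≤ X} g(n) conj g(n+1)|/X = 0`: what Theorem
B.1 obstructs is the `lim sup`, i.e. ALL-scales statements.
[cite: KlurmanMangerelTeravainen2023, Theorem 1.2 and Proposition 1.3]
[cite: MatomakiRadziwillTao2015, Appendix B, Theorem B.1] -/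
theorem not_counterexample_allScales (hKMT : KlurmanMangerelTeravainen2023_twoPoint) :
    ¬ ∃ g : ArithmeticFunction ℂ, g.IsMultiplicative ∧ (∀ n, ‖g n‖ ≤ 1) ∧
        IsPointwiseNonpretentious g ∧ ∃ c : ℝ, 0 < c ∧
          ∀ᶠ X : ℕ in atTop, c * (X : ℝ) ≤ ‖∑ n ∈ Icc 1 X, g n * conj (g (n + 1))‖ := by
  rintro ⟨g, hmult, hbd, hnp, c, hc, hall⟩
  obtain ⟨𝒳, hdens, hcorr⟩ := hKMT g (conjFun g) hmult (isMultiplicative_conjFun hmult) hbd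
    (fun n => by simpa using hbd n) hnp
  have h12 := hcorr 1 2 le_rfl (by norm_num) (by norm_num)
  -- (a) eventually along `𝒳`: the shifted correlation is `< (c/4) x` in norm
  have hsmall : ∀ᶠ x : ℕ in atTop, x ∈ 𝒳 →
      ‖(∑ n ∈ Icc 1 x, g (n + 1) * conjFun g (n + 2)) / (x : ℂ)‖ < c / 4 := by
    have := (Metric.tendsto_nhds.1 h12) (c / 4) (by positivity)
    rw [Filter.eventually_inf_principal] at this
    filter_upwards [this] with x hx hmem
    simpa [dist_zero_right] using hx hmem
  -- (b) eventually: the all-scales lower bound at `X = x + 1`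
  have hbig : ∀ᶠ x : ℕ in atTop,
      c * ((x + 1 : ℕ) : ℝ) ≤ ‖∑ n ∈ Icc 1 (x + 1), g n * conj (g (n + 1))‖ :=
    (tendsto_add_atTop_nat 1).eventually hall
  obtain ⟨N, hN⟩ := eventually_atTop.1 (hsmall.and (hbig.and (eventually_ge_atTop ⌈2 / c⌉₊)))
  -- (c) a scale in `𝒳` beyond `N`
  have hfreq : ∃ᶠ X : ℕ in atTop, (1 / 2 : ℝ) ≤ logMean (Set.indicator 𝒳 1) X := by
    have := hdens (1 / 2) (by norm_num)
    exact this.mono fun X hX => by linarith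
  obtain ⟨x, hx𝒳, hxN⟩ := exists_mem_gt_of_frequently_logMean hfreq N
  obtain ⟨h1, h2, h3⟩ := hN x hxN.le
  have h1 := h1 hx𝒳
  -- (d) arithmetic
  have hx0 : (0 : ℝ) < x := by exact_mod_cast (lt_of_le_of_lt (Nat.zero_le N) hxN)
  have hxc : 2 / c ≤ (x : ℝ) := (Nat.le_ceil _).trans (by exact_mod_cast h3)
  have hcx : 2 ≤ c * x := by
    rw [div_le_iff₀ hc] at hxc
    linarith
  set S' : ℂ := ∑ n ∈ Icc 1 x, g (n + 1) * conjFun g (n + 2) with hS'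
  have hS'norm : ‖S'‖ < c / 4 * x := by
    rw [norm_div, Complex.norm_natCast, div_lt_iff₀ hx0] at h1
    exact h1
  have hdecomp : ∑ n ∈ Icc 1 (x + 1), g n * conj (g (n + 1)) = g 1 * conj (g 2) + S' := by
    rw [hS', sum_Icc_succ_eq_add_sum_shift (fun n => g n * conj (g (n + 1))) x]
    simp only [conjFun_apply]
  have hfirst : ‖g 1 * conj (g 2)‖ ≤ 1 := by
    rw [norm_mul, Complex.norm_conj]
    exact mul_le_one₀ (hbd 1) (norm_nonneg _) (hbd 2)
  have hup : ‖∑ n ∈ Icc 1 (x + 1), g n * conj (g (n + 1))‖ ≤ 1 + c / 4 * x := by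
    rw [hdecomp]
    exact (norm_add_le _ _).trans (by linarith)
  have hcast : ((x + 1 : ℕ) : ℝ) = (x : ℝ) + 1 := by push_cast; ring
  rw [hcast] at h2
  nlinarith

end Literature.Barriers.Parity
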